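import Summits.CriticalPhenomena.SAWScalingLimit.Theses.SAWReversalUpgrade
import HarnessLib

/-!
# Strategist r1 sketch — crux stmt-CriticalPhenomena-18004 `SAWReversalUpgrade.NoDeepReturn`

Typed companions of `STRATEGY-CENSUS.md` (r1 second opinion, seat
`planner-cstrat-stmt-CriticalPhenomena-18004-r1-0`, 2026-08-17). DEFINITIONS ONLY plus trivial
lemmas; no `sorry`. Every statement below is an object of the census (a strengthening, a piece of a
decomposition, or an atom exposed by one of the round-2 ideas), typed over tree declarations so
that refuters and later seats can cite it by name. Verdicts live in the docstrings and in the census.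

* §1 events and the OUTER-LATTICE-COMPONENT cut of idea `excursion-yardstick-root` (ideator 5);
* §2 strengthenings S⁺₅ `OuterCutDiveRatio` (η-free fixed-geometry ratio — predicted FALSE by the
  rim defect), S⁺₆ `OuterCutSupDive` (sup over outer-cut pasts, tips `θρ`-inside — not refutable by
  forcing, proof needs SAW tip separation = obstruction (α));
* §3 decomposition D5 (the yardstick architecture in SAW-only form): `RootLayerRarity`,
  `FillGeometry`, `OuterMarkovReduction`, and the glue STATEMENT `OuterCutGlue` (not proved here).
-/

noncomputable section

namespace Summit.CriticalPhenomena.SAWScalingLimit.Cruxes.NoDeepReturn.StrategistR1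

open MeasureTheory Filter Topology Set Metric
open scoped NNReal ENNReal
open Literature.Probability.RandomPlanarGeometry
open Literature.Probability.RandomPlanarGeometry.SAW
open Literature.Probability.LatticeModels (Site meshPoint meshDomain discreteDomainGraph)

/-- The crux, by name. -/
abbrev Crux : Prop := Summit.CriticalPhenomena.SAWScalingLimit.Theses.SAWReversalUpgrade.NoDeepReturn

/-! ## §1 Events and the outer-component cut -/

/-- The OUTER LATTICE COMPONENT at radius `ρ` about `c`, relative to the target `w`: vertices joined
to `w` by a lattice path of `Ω_δ` all of whose vertices lie strictly outside `B̄(c, ρ)`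
(ideator 5's `outerComp`; pasts cut at the first visit of this set cannot FORCE a dive: the tip has
a past-free route to `w` outside the ball). [folklore] -/
def outerComp (Ω : Set ℂ) (δ : ℝ) (c : ℂ) (ρ : ℝ) (w : Site 2) : Set (Site 2) :=
  {v | ∃ p : (discreteDomainGraph Ω δ).Walk v w, ∀ u ∈ p.support, ρ < dist (meshPoint δ u) c}

/-- The target itself is in its outer component as soon as it lies outside the closed ball.
[folklore] -/
theorem self_mem_outerComp {Ω : Set ℂ} {δ : ℝ} {c : ℂ} {ρ : ℝ} {w : Site 2}
    (hw : ρ < dist (meshPoint δ w) c) : w ∈ outerComp Ω δ c ρ w := by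
  refine ⟨SimpleGraph.Walk.nil, ?_⟩
  intro u hu
  simp only [SimpleGraph.Walk.support_nil, List.mem_singleton] at hu
  subst hu
  exact hw

/-- Every vertex of the outer component lies strictly outside the closed ball. [folklore] -/
theorem dist_lt_of_mem_outerComp {Ω : Set ℂ} {δ : ℝ} {c : ℂ} {ρ : ℝ} {w v : Site 2}
    (hv : v ∈ outerComp Ω δ c ρ w) : ρ < dist (meshPoint δ v) c := by
  obtain ⟨p, hp⟩ := hv
  exact hp v p.start_mem_support

/-- A FIRST-OUTER PAST: a self-avoiding lattice prefix from `u` to `z` none of whose vertices but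
the last lies in the outer component, the last one does. [folklore] -/
def FirstOuterPast (Ω : Set ℂ) (δ : ℝ) (c : ℂ) (ρ : ℝ) (w : Site 2) {u z : Site 2}
    (α : (discreteDomainGraph Ω δ).Walk u z) : Prop :=
  α.IsPath ∧ (∀ y ∈ α.support.dropLast, y ∉ outerComp Ω δ c ρ w) ∧ z ∈ outerComp Ω δ c ρ w

/-- The continuation avoids the past (all vertices of `β` off `α` minus its tip). [folklore] -/
def AvoidsPast {Ω : Set ℂ} {δ : ℝ} {u x v : Site 2} (α : (discreteDomainGraph Ω δ).Walk u x)
    (β : DomainSAW Ω δ x v) : Prop :=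
  ∀ w ∈ β.walk.support, w ∉ α.support.dropLast

/-- The continuation DIVES into `N` (visits a vertex with mesh point in `N`). [folklore] -/
def Dives {Ω : Set ℂ} {δ : ℝ} {x v : Site 2} (N : Set ℂ) (β : DomainSAW Ω δ x v) : Prop :=
  ∃ j ≤ β.walk.length, meshPoint δ (β.walk.getVert j) ∈ N

/-- The continuation stays strictly outside the closed ball `B̄(c, ρ)` after its start
(outer-confined continuation; its start may sit on the rim). [folklore] -/
def StaysOutside {Ω : Set ℂ} {δ : ℝ} {x v : Site 2} (c : ℂ) (ρ : ℝ) (β : DomainSAW Ω δ x v) :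
    Prop :=
  ∀ j ≤ β.walk.length, 0 < j → ρ < dist (meshPoint δ (β.walk.getVert j)) c

/-! ## §2 Strengthenings exposed by the round-2 ideas (typed; fates in the census) -/

/-- S⁺₅ `OuterCutDiveRatio` — the η-FREE, FIXED-GEOMETRY shortcut behind `RootYardstick`(ii):
for tips `z` of the outer component within one mesh of the sphere `∂B(a, ρ)` and `θρ`-inside `D`,
the UNCONDITIONED dive weight `Z_D(z → b_δ; dives B̄(a,r))` is at most `η` times the OUTER-CONFINED
weight `Z(z → b_δ; stays outside B̄(a,ρ))`. It implies the sup-form S⁺₆ (numerator up, denominator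
down are both monotone and past-free). PREDICTED FALSE for every admissible `(D, a)` by the rim
defect (census §Strengthen S⁺₅): the confined denominator starts ON the rim of its allowed region and
pays the boundary-start penalty `(δ/ρ)^{x₁ᵇ − x₁} = (δ/ρ)^{25/48} → 0` relative to `Z_D(z → b_δ)`,
while the numerator is `δ`-free, `≍ (r/ρ)^{2} · Z_D(z → b_δ)` (boundary hairpin at `a`). Same
exponent inequality as `Disproof.lean` §5. Not a usable piece. -/
def OuterCutDiveRatio (θ : ℝ) : Prop :=
  ∀ (D : DobrushinDomain) (a b : ℝ → Site 2), IsEndpointApprox D a b →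
    ∀ ε : ℝ, 0 < ε → ∀ η : ℝ, 0 < η → ∃ ρ₀ : ℝ, 0 < ρ₀ ∧ ρ₀ < ε ∧ ∀ ρ : ℝ, 0 < ρ → ρ ≤ ρ₀ →
      ∃ r : ℝ, 0 < r ∧ r < ρ ∧ ∀ᶠ δ in 𝓝[>] (0 : ℝ), ∀ z : Site 2,
        z ∈ outerComp D.carrier δ (D.pt 0) ρ (b δ) → dist (meshPoint δ z) (D.pt 0) ≤ ρ + δ →
          θ * ρ ≤ infDist (meshPoint δ z) D.carrierᶜ →
            weight D.carrier δ z (b δ) {β | Dives (closedBall (D.pt 0) r) β}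
              ≤ ENNReal.ofReal η * weight D.carrier δ z (b δ) {β | StaysOutside (D.pt 0) ρ β}

/-- S⁺₆ `OuterCutSupDive` — SUP over first-outer pasts of the CONDITIONAL dive weight, tips
`θρ`-inside (= `RootYardstick`(ii) ∘ `RootBeurling` of idea `excursion-yardstick-root` with the
random walk eliminated): every first-outer past `α` with tip `z` has continuation weight of
"avoid `α` and dive into `B̄(a,r)`" at most `η` times that of "avoid `α`", uniformly in small `δ`.
Unlike `Strategist.RootPenetrationSupAt ballCut/componentCut` (b1, refuted by finger + junction
near-touch + start gap) it is NOT refutable by forcing: the tip has an `α`-free route to `b_δ`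
outside the ball by definition of `outerComp`. Its truth, however, requires the start penalty at the
tip (the continuation starts adjacent to `α`'s last-but-one vertex inside the ball) to CANCEL between
numerator and denominator — a boundary-Harnack / separation property of two-pinned `x_c`-partition
functions at a cut point (census obstruction (α)); no tool on `ℤ²` (nor on the hexagonal lattice).
Open; crux-class. -/
def OuterCutSupDive (θ : ℝ) : Prop :=
  ∀ (D : DobrushinDomain) (a b : ℝ → Site 2), IsEndpointApprox D a b →
    ∀ ε : ℝ, 0 < ε → ∀ η : ℝ, 0 < η → ∃ ρ₀ : ℝ, 0 < ρ₀ ∧ ρ₀ < ε ∧ ∀ ρ : ℝ, 0 < ρ → ρ ≤ ρ₀ →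
      ∃ r : ℝ, 0 < r ∧ r < ρ ∧ ∀ᶠ δ in 𝓝[>] (0 : ℝ),
        ∀ (z : Site 2) (α : (discreteDomainGraph D.carrier δ).Walk (a δ) z),
          FirstOuterPast D.carrier δ (D.pt 0) ρ (b δ) α → θ * ρ ≤ infDist (meshPoint δ z) D.carrierᶜ →
            weight D.carrier δ z (b δ) {β | AvoidsPast α β ∧ Dives (closedBall (D.pt 0) r) β}
              ≤ ENNReal.ofReal η * weight D.carrier δ z (b δ) {β | AvoidsPast α β}

/-- S⁺₅ ⇒ S⁺₆ pointwise: the past-free ratio dominates the conditional one (drop the avoidance in the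
numerator; an outer-confined continuation from an outer tip avoids every first-outer past, whose
non-tip vertices lie off the outer component and hence — along the continuation's own outer route —
… ). Recorded as a STATEMENT only: the second monotonicity needs "outer-confined continuations avoid
the past", which holds because every vertex of such a continuation is in `outerComp` (joined to
`b_δ` by its own tail outside the ball) while the past's non-tip vertices are not. [folklore] -/
def DiveRatio_implies_SupDive (θ : ℝ) : Prop := OuterCutDiveRatio θ → OuterCutSupDive θ

/-! ## §3 Decomposition D5 — the outer-cut architecture in SAW-only form (typed, NOT filed) -/

/-- Piece `RootLayerRarity` (open; NeverTouch / boundary-proximity class, cf. stmt-4863): the first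
outer-component vertex at scale `ρ` lies within `θρ` of `∂D` with small probability, for `θ` small,
UNIFORMLY in small `ρ` (a fixed clearance `s` fails trivially: the tip is within `ρ + δ` of
`a ∈ ∂D`). This is `RootYardstick`(i) + `ExcursionBoundaryProximity` of the idea card with the
random walk eliminated; it is a root-scale boundary one-arm smallness for the two-pinned `x_c`-SAW —
no tool. -/
def RootLayerRarity : Prop :=
  ∀ (D : DobrushinDomain) (a b : ℝ → Site 2), IsEndpointApprox D a b →
    ∀ η : ℝ, 0 < η → ∃ θ : ℝ, 0 < θ ∧ ∃ ρ₀ : ℝ, 0 < ρ₀ ∧ ∀ ρ : ℝ, 0 < ρ → ρ ≤ ρ₀ →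
      ∀ᶠ δ in 𝓝[>] (0 : ℝ), law D.carrier δ (a δ) (b δ)
        {γ | ∃ i ≤ γ.walk.length, (∀ k < i, γ.walk.getVert k ∉ outerComp D.carrier δ (D.pt 0) ρ (b δ)) ∧
          γ.walk.getVert i ∈ outerComp D.carrier δ (D.pt 0) ρ (b δ) ∧
          infDist (meshPoint δ (γ.walk.getVert i)) D.carrierᶜ < θ * ρ} ≤ ENNReal.ofReal η

/-- Piece `FillGeometry` (provable, L; Jordan topology + lattice approximation): two `ε`-far,
`s`-inside vertices of `Ω_δ` are joined by a lattice path strictly outside `B̄(a, ρ)` once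
`ρ ≤ ρ₀(D, ε, s)` and `δ` is small (the `s/2`-interior of `D` is compact and lies in one component
of some `t`-interior; `a ∈ ∂D` is at distance `≥ t` from it; fine meshes resolve the `t`-interior). -/
def FillGeometry : Prop :=
  ∀ (D : DobrushinDomain) (ε s : ℝ), 0 < ε → 0 < s → ∃ ρ₀ : ℝ, 0 < ρ₀ ∧ ∀ ρ : ℝ, 0 < ρ → ρ ≤ ρ₀ →
    ∀ᶠ δ in 𝓝[>] (0 : ℝ), ∀ v w : Site 2, v ∈ meshDomain D.carrier δ → w ∈ meshDomain D.carrier δ →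
      ε ≤ dist (meshPoint δ v) (D.pt 0) → ε ≤ dist (meshPoint δ w) (D.pt 0) →
        s ≤ infDist (meshPoint δ v) D.carrierᶜ → s ≤ infDist (meshPoint δ w) D.carrierᶜ →
          ∃ p : (discreteDomainGraph D.carrier δ).Walk v w, ∀ u ∈ p.support, ρ < dist (meshPoint δ u) (D.pt 0)

/-- Piece `OuterMarkovReduction` (provable, L; exact domain Markov summed over first-outer prefixes,
the law-level cousin of the landed `stub_firstEntranceFarBound`, p159214): a conditional bound at
every GOOD first-outer tip gives a law bound on "first outer vertex is good, a later vertex is in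
`N`". -/
def OuterMarkovReduction : Prop :=
  ∀ (Ω : Set ℂ), Bornology.IsBounded Ω → ∀ δ : ℝ, 0 < δ → ∀ (c : ℂ) (ρ : ℝ) (u w : Site 2)
    (G : Set (Site 2)) (N : Set ℂ) (η : ℝ), 0 ≤ η → u ∉ outerComp Ω δ c ρ w →
    (∀ (z : Site 2) (α : (discreteDomainGraph Ω δ).Walk u z), FirstOuterPast Ω δ c ρ w α → z ∈ G →
      weight Ω δ z w {β | AvoidsPast α β ∧ Dives N β}
        ≤ ENNReal.ofReal η * weight Ω δ z w {β | AvoidsPast α β}) →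
    law Ω δ u w {γ | ∃ i j : ℕ, i ≤ j ∧ j ≤ γ.walk.length ∧
        (∀ k < i, γ.walk.getVert k ∉ outerComp Ω δ c ρ w) ∧ γ.walk.getVert i ∈ outerComp Ω δ c ρ w ∧
        γ.walk.getVert i ∈ G ∧ meshPoint δ (γ.walk.getVert j) ∈ N} ≤ ENNReal.ofReal η

/-- Piece `PolylineToVertex` (LANDED in substance as `NakedRoot.stub_polylineToVertex`, p158730):
polyline far/near event ⇒ vertex far/near event with one mesh of room. Restated here to keep the
glue statement self-contained. -/
def PolylineToVertex : Prop :=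
  ∀ (Ω : Set ℂ) (δ : ℝ) (u v : Site 2) (γ : DomainSAW Ω δ u v) (c : ℂ) (ε r : ℝ),
    0 < δ → r + δ < ε →
      (∃ s t : unitInterval, s < t ∧ ε ≤ dist (γ.walk.toCurve (meshPoint δ) s) c ∧
        dist (γ.walk.toCurve (meshPoint δ) t) c ≤ r) →
      ∃ i j : ℕ, i < j ∧ j ≤ γ.walk.length ∧ ε ≤ dist (meshPoint δ (γ.walk.getVert i)) c ∧
        dist (meshPoint δ (γ.walk.getVert j)) c ≤ r + δ

/-- D5 GLUE, as a STATEMENT (not proved in this census; ideator 5's composition `crux_of_yardstick`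
is likewise `sorry`'d). Composition in words: shrink `ε` below `dist(a,b)/8`; off two layer events
(`RootLayerRarity` at the cut radius `ρ` for the tip, and at the mid radius `dist(a,b)/8` for the
walk's final passage) the first `ε`-far vertex is `s`-inside or layer-bad; if inside, `FillGeometry`
joins it outside `B̄(a,ρ)` to an inside vertex of the final passage, which the walk's own tail joins
to `b_δ` outside the ball, so it lies in `outerComp(ρ)` and the first-outer index precedes the far
index, hence the near index; `OuterCutSupDive` at good tips + `OuterMarkovReduction` bound that
event; `PolylineToVertex` converts. WHICH PIECES REMAIN THE CRUX: `OuterCutSupDive` (tip separation,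
obstruction (α)) and `RootLayerRarity` (root-scale boundary proximity) — both open, both of the
class the census identifies; the other three are bookkeeping/topology. Hence NOT filed as a split. -/
def OuterCutGlue (θ : ℝ) : Prop :=
  OuterCutSupDive θ → RootLayerRarity → FillGeometry → OuterMarkovReduction → PolylineToVertex → Crux

/-! ## §4 Sanity lemmas (the typed objects are non-degenerate where cheaply checkable) -/

/-- The start vertex of a first-outer past with at least one edge is NOT in the outer component
(it is a non-tip vertex). [folklore] -/
theorem start_not_mem_of_firstOuterPast {Ω : Set ℂ} {δ : ℝ} {c : ℂ} {ρ : ℝ} {w u z : Site 2}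
    {α : (discreteDomainGraph Ω δ).Walk u z} (h : FirstOuterPast Ω δ c ρ w α) (hne : u ≠ z) :
    u ∉ outerComp Ω δ c ρ w := by
  rcases h with ⟨-, hoff, -⟩
  apply hoff
  cases α with
  | nil => exact absurd rfl hne
  | cons hadj p =>
    simp [SimpleGraph.Walk.support_cons, List.dropLast_cons_of_ne_nil (SimpleGraph.Walk.support_ne_nil p)]

/-- The tip of a first-outer past lies strictly outside the closed ball. [folklore] -/
theorem tip_dist_lt_of_firstOuterPast {Ω : Set ℂ} {δ : ℝ} {c : ℂ} {ρ : ℝ} {w u z : Site 2}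
    {α : (discreteDomainGraph Ω δ).Walk u z} (h : FirstOuterPast Ω δ c ρ w α) :
    ρ < dist (meshPoint δ z) c :=
  dist_lt_of_mem_outerComp h.2.2

end Summit.CriticalPhenomena.SAWScalingLimit.Cruxes.NoDeepReturn.StrategistR1

end
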